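import Summits.Ventures.PercRepro.RankLevelSetSpanningTriangles

/-!
# PercRepro — THE SPANNING TAIL CUT BY THREE TRIANGLES (p8 g14, S3)

Three triangles meeting pairwise in at most one point have union nullity `≥ 3` (RankLevelSetSpanningTriangles), so the
complements of the spanning sets of size `d` meet all three, those of size `d − 1` miss at most one, those of size `d − 2`
meet at least one: **`ncard_spanning_le_three_triangles`** —
`#spanning + C(n − 9, d − 2) + C(n − 6, d − 1) + 3·C(n − 3, d) + C(n − 9, d) ≤ Σ_{j ≤ d} C(n, j) + 3·C(n − 5, d)`
(the pairwise unions have `5 ≤ |T_i ∪ T_j| ≤ 6`, the triple union `≤ 9`). Axioms: standard.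
-/

namespace PercRepro

open Finset Set

variable {α : Type*}

namespace Matroid

variable {M : _root_.Matroid α} [M.Finite]

/-! ### The spanning tail with three triangles -/

/-- **THE SPANNING TAIL CUT BY THREE TRIANGLES.** In a finite matroid with `|E| = r(E) + d`, `d ≥ 3`, `n = |E|`, and three
triangles meeting pairwise in at most one point:
`#spanning + C(n − 9, d − 2) + C(n − 6, d − 1) + 3·C(n − 3, d) + C(n − 9, d) ≤ Σ_{j ≤ d} C(n, j) + 3·C(n − 5, d)` — the
complements of size `d` meet all three triangles, those of size `d − 1` miss at most one, those of size `d − 2` meet one. -/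
theorem ncard_spanning_le_three_triangles {d : ℕ} (hd : M.E.encard = M.eRank + d) (hd3 : 3 ≤ d)
    {T₁ T₂ T₃ : Set α} (h1 : M.IsCircuit T₁) (h2 : M.IsCircuit T₂) (h3 : M.IsCircuit T₃)
    (hc1 : T₁.ncard = 3) (hc2 : T₂.ncard = 3) (hc3 : T₃.ncard = 3)
    (h12 : (T₁ ∩ T₂).ncard ≤ 1) (h13 : (T₁ ∩ T₃).ncard ≤ 1) (h23 : (T₂ ∩ T₃).ncard ≤ 1) :
    {X : Set α | X ⊆ M.E ∧ M.eRk X = M.eRank}.ncard + (M.ground_finite.toFinset.card - 9).choose (d - 2)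
        + (M.ground_finite.toFinset.card - 6).choose (d - 1)
        + 3 * (M.ground_finite.toFinset.card - 3).choose d + (M.ground_finite.toFinset.card - 9).choose d ≤
      (∑ j ∈ Finset.range (d + 1), M.ground_finite.toFinset.card.choose j)
        + 3 * (M.ground_finite.toFinset.card - 5).choose d := by
  classical
  obtain ⟨m, rfl⟩ : ∃ m, d = m + 3 := ⟨d - 3, by omega⟩
  have hE : (M.ground_finite.toFinset : Set α) = M.E := Set.Finite.coe_toFinset _
  have hT1E : T₁ ⊆ M.E := h1.subset_ground
  have hT2E : T₂ ⊆ M.E := h2.subset_ground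
  have hT3E : T₃ ⊆ M.E := h3.subset_ground
  have hT1f : T₁.Finite := M.ground_finite.subset hT1E
  have hT2f : T₂.Finite := M.ground_finite.subset hT2E
  have hT3f : T₃.Finite := M.ground_finite.subset hT3E
  -- distinctness from the pairwise intersections
  have hne12 : T₁ ≠ T₂ := by
    intro h; rw [h, Set.inter_self] at h12; omega
  have hne13 : T₁ ≠ T₃ := by
    intro h; rw [h, Set.inter_self] at h13; omega
  have hne23 : T₂ ≠ T₃ := by
    intro h; rw [h, Set.inter_self] at h23; omega
  have hS1 : (hT1f.toFinset : Set α) = T₁ := Set.Finite.coe_toFinset _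
  have hS2 : (hT2f.toFinset : Set α) = T₂ := Set.Finite.coe_toFinset _
  have hS3 : (hT3f.toFinset : Set α) = T₃ := Set.Finite.coe_toFinset _
  have hS1E : hT1f.toFinset ⊆ M.ground_finite.toFinset := by
    rw [← Finset.coe_subset, hS1, hE]; exact hT1E
  have hS2E : hT2f.toFinset ⊆ M.ground_finite.toFinset := by
    rw [← Finset.coe_subset, hS2, hE]; exact hT2E
  have hS3E : hT3f.toFinset ⊆ M.ground_finite.toFinset := by
    rw [← Finset.coe_subset, hS3, hE]; exact hT3E
  have hc1' : hT1f.toFinset.card = 3 := by rw [← hc1, Set.ncard_eq_toFinset_card T₁ hT1f]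
  have hc2' : hT2f.toFinset.card = 3 := by rw [← hc2, Set.ncard_eq_toFinset_card T₂ hT2f]
  have hc3' : hT3f.toFinset.card = 3 := by rw [← hc3, Set.ncard_eq_toFinset_card T₃ hT3f]
  -- the union cardinalities: pairs `≥ 5`, the triple `≤ 9`
  have hpair : ∀ (S S' : Set α) (hS : S.Finite) (hS' : S'.Finite), S.ncard = 3 → S'.ncard = 3 →
      (S ∩ S').ncard ≤ 1 → 5 ≤ (hS.toFinset ∪ hS'.toFinset).card := by
    intro S S' hS hS' hcS hcS' hSS
    have hui := Set.ncard_union_add_ncard_inter S S' hS hS'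
    have : ((hS.toFinset ∪ hS'.toFinset : Finset α) : Set α).ncard = (S ∪ S').ncard := by
      rw [Finset.coe_union, Set.Finite.coe_toFinset, Set.Finite.coe_toFinset]
    rw [Set.ncard_coe_finset] at this
    omega
  have hu12 := hpair T₁ T₂ hT1f hT2f hc1 hc2 h12
  have hu13 := hpair T₁ T₃ hT1f hT3f hc1 hc3 h13
  have hu23 := hpair T₂ T₃ hT2f hT3f hc2 hc3 h23
  have hu123 : (hT1f.toFinset ∪ hT2f.toFinset ∪ hT3f.toFinset).card ≤ 9 := by
    have h1' := Finset.card_union_le (hT1f.toFinset ∪ hT2f.toFinset) hT3f.toFinset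
    have h2' := Finset.card_union_le hT1f.toFinset hT2f.toFinset
    omega
  have hSU12 : hT1f.toFinset ∪ hT2f.toFinset ⊆ M.ground_finite.toFinset := Finset.union_subset hS1E hS2E
  have hSU13 : hT1f.toFinset ∪ hT3f.toFinset ⊆ M.ground_finite.toFinset := Finset.union_subset hS1E hS3E
  have hSU23 : hT2f.toFinset ∪ hT3f.toFinset ⊆ M.ground_finite.toFinset := Finset.union_subset hS2E hS3E
  have hSU : hT1f.toFinset ∪ hT2f.toFinset ∪ hT3f.toFinset ⊆ M.ground_finite.toFinset :=
    Finset.union_subset hSU12 hS3E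
  set E' := M.ground_finite.toFinset with hE'
  set n := E'.card with hn
  -- the four target families
  set Y₀ := {Y : Set α | Y ⊆ (E' : Set α) ∧ Y.ncard ≤ m} with hY₀
  set Y₁ := {Y : Set α | Y ⊆ (E' : Set α) ∧ Y.ncard = m + 1 ∧
    ((Y ∩ T₁).Nonempty ∨ (Y ∩ T₂).Nonempty ∨ (Y ∩ T₃).Nonempty)} with hY₁
  set Y₂ := {Y : Set α | Y ⊆ (E' : Set α) ∧ Y.ncard = m + 2 ∧
    (((Y ∩ T₁).Nonempty ∨ (Y ∩ T₂).Nonempty) ∧ ((Y ∩ T₁).Nonempty ∨ (Y ∩ T₃).Nonempty) ∧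
      ((Y ∩ T₂).Nonempty ∨ (Y ∩ T₃).Nonempty))} with hY₂
  set Y₃ := {Y : Set α | Y ⊆ (E' : Set α) ∧ Y.ncard = m + 3 ∧
    ((Y ∩ T₁).Nonempty ∧ (Y ∩ T₂).Nonempty ∧ (Y ∩ T₃).Nonempty)} with hY₃
  have hfin₀ : Y₀.Finite := (E'.finite_toSet.finite_subsets).subset (fun Y hY => hY.1)
  have hfin₁ : Y₁.Finite := (E'.finite_toSet.finite_subsets).subset (fun Y hY => hY.1)
  have hfin₂ : Y₂.Finite := (E'.finite_toSet.finite_subsets).subset (fun Y hY => hY.1)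
  have hfin₃ : Y₃.Finite := (E'.finite_toSet.finite_subsets).subset (fun Y hY => hY.1)
  -- the complement map
  have hinj : Set.InjOn (fun X : Set α => M.E \ X) {X : Set α | X ⊆ M.E ∧ M.eRk X = M.eRank} := by
    intro X hX Y hY hXY
    simp only at hXY
    rw [← Set.sdiff_sdiff_cancel_left hX.1, hXY, Set.sdiff_sdiff_cancel_left hY.1]
  have hR : M.eRank ≠ ⊤ := (M.eRank_ne_top_iff).2 inferInstance
  have hmaps : ∀ X ∈ {X : Set α | X ⊆ M.E ∧ M.eRk X = M.eRank},
      (fun X : Set α => M.E \ X) X ∈ Y₀ ∪ Y₁ ∪ Y₂ ∪ Y₃ := by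
    intro X hX
    show M.E \ X ∈ Y₀ ∪ Y₁ ∪ Y₂ ∪ Y₃
    obtain ⟨hle, hsum⟩ := diff_ncard_le_of_spanning hd hX.1 hX.2
    have hYE : M.E \ X ⊆ (E' : Set α) := by rw [hE]; exact Set.sdiff_subset
    have hfinY : (M.E \ X).Finite := M.ground_finite.subset Set.sdiff_subset
    have hcastY : (M.E \ X).encard = ((M.E \ X).ncard : ℕ∞) := hfinY.cast_ncard_eq.symm
    -- `|X| = r(E) + (d − |E ∖ X|)`
    have hXcard : ∀ t : ℕ, (M.E \ X).ncard + t = m + 3 → X.encard = M.eRank + t := by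
      intro t ht
      rw [hcastY] at hsum
      have hsum' : X.encard + ((M.E \ X).ncard : ℕ∞) = (M.eRank + t) + ((M.E \ X).ncard : ℕ∞) := by
        rw [hsum, ← ht]; push_cast; ring
      exact (ENat.add_le_add_iff_right (by simp)).1 hsum'.le |>.antisymm
        ((ENat.add_le_add_iff_right (by simp)).1 hsum'.ge)
    rcases Nat.lt_or_ge (M.E \ X).ncard (m + 1) with hlt | hge
    · exact Or.inl (Or.inl (Or.inl ⟨hYE, by omega⟩))
    rcases Nat.lt_or_ge (M.E \ X).ncard (m + 2) with hlt2 | hge2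
    · have hm1 : (M.E \ X).ncard = m + 1 := by omega
      exact Or.inl (Or.inl (Or.inr ⟨hYE, hm1,
        diff_inter_nonempty_two_of_three_of_spanning hX.2 (hXcard 2 (by omega)) h1 h2 h3 hne12 hc3 h13 h23⟩))
    rcases Nat.lt_or_ge (M.E \ X).ncard (m + 3) with hlt3 | hge3
    · have hm2 : (M.E \ X).ncard = m + 2 := by omega
      have hX1 := hXcard 1 (by omega)
      exact Or.inl (Or.inr ⟨hYE, hm2,
        diff_inter_nonempty_or_of_spanning_of_encard_succ hX.2 hX1 h1 h2 hne12,
        diff_inter_nonempty_or_of_spanning_of_encard_succ hX.2 hX1 h1 h3 hne13,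
        diff_inter_nonempty_or_of_spanning_of_encard_succ hX.2 hX1 h2 h3 hne23⟩)
    · have hm3 : (M.E \ X).ncard = m + 3 := by omega
      have hX0 : X.encard = M.eRank := by simpa using hXcard 0 (by omega)
      exact Or.inr ⟨hYE, hm3, diff_inter_nonempty_of_spanning_of_encard hX.1 hX.2 hX0 h1,
        diff_inter_nonempty_of_spanning_of_encard hX.1 hX.2 hX0 h2,
        diff_inter_nonempty_of_spanning_of_encard hX.1 hX.2 hX0 h3⟩
  have hmain : {X : Set α | X ⊆ M.E ∧ M.eRk X = M.eRank}.ncard ≤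
      Y₀.ncard + Y₁.ncard + Y₂.ncard + Y₃.ncard := by
    calc {X : Set α | X ⊆ M.E ∧ M.eRk X = M.eRank}.ncard ≤ (Y₀ ∪ Y₁ ∪ Y₂ ∪ Y₃).ncard :=
          Set.ncard_le_ncard_of_injOn _ hmaps hinj (((hfin₀.union hfin₁).union hfin₂).union hfin₃)
      _ ≤ (Y₀ ∪ Y₁ ∪ Y₂).ncard + Y₃.ncard := Set.ncard_union_le _ _
      _ ≤ Y₀.ncard + Y₁.ncard + Y₂.ncard + Y₃.ncard := by
          have := Set.ncard_union_le (Y₀ ∪ Y₁) Y₂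
          have := Set.ncard_union_le Y₀ Y₁
          omega
  -- the four counts
  have hcoe : ∀ (s : Finset α), (((s : Set α) ∩ T₁).Nonempty ↔ (s ∩ hT1f.toFinset).Nonempty) ∧
      (((s : Set α) ∩ T₂).Nonempty ↔ (s ∩ hT2f.toFinset).Nonempty) ∧
      (((s : Set α) ∩ T₃).Nonempty ↔ (s ∩ hT3f.toFinset).Nonempty) := by
    intro s
    simp only [← Finset.coe_nonempty, Finset.coe_inter, hS1, hS2, hS3, and_self]
  have h₀ : Y₀.ncard ≤ ∑ j ∈ Finset.range (m + 1), n.choose j := ncard_subsets_ncard_le E' m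
  have h₁ : Y₁.ncard + (E' \ (hT1f.toFinset ∪ hT2f.toFinset ∪ hT3f.toFinset)).card.choose (m + 1) =
      n.choose (m + 1) := by
    rw [hY₁, ncard_subsets_ncard_eq_filter E' (m + 1)
      (fun Y : Set α => (Y ∩ T₁).Nonempty ∨ (Y ∩ T₂).Nonempty ∨ (Y ∩ T₃).Nonempty)]
    have hcongr : (E'.powersetCard (m + 1)).filter
        (fun s : Finset α => ((s : Set α) ∩ T₁).Nonempty ∨ ((s : Set α) ∩ T₂).Nonempty ∨
          ((s : Set α) ∩ T₃).Nonempty) =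
        (E'.powersetCard (m + 1)).filter
        (fun s : Finset α => (s ∩ hT1f.toFinset).Nonempty ∨ (s ∩ hT2f.toFinset).Nonempty ∨
          (s ∩ hT3f.toFinset).Nonempty) := by
      apply Finset.filter_congr
      intro s _
      rw [(hcoe s).1, (hcoe s).2.1, (hcoe s).2.2]
    rw [hcongr]
    exact card_filter_meets_one_of_three E' _ _ _ (m + 1)
  have h₂ : Y₂.ncard + (E' \ (hT1f.toFinset ∪ hT2f.toFinset)).card.choose (m + 2) ≤ n.choose (m + 2) := by
    rw [hY₂, ncard_subsets_ncard_eq_filter E' (m + 2)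
      (fun Y : Set α => ((Y ∩ T₁).Nonempty ∨ (Y ∩ T₂).Nonempty) ∧ ((Y ∩ T₁).Nonempty ∨ (Y ∩ T₃).Nonempty) ∧
        ((Y ∩ T₂).Nonempty ∨ (Y ∩ T₃).Nonempty))]
    have hcongr : (E'.powersetCard (m + 2)).filter
        (fun s : Finset α => (((s : Set α) ∩ T₁).Nonempty ∨ ((s : Set α) ∩ T₂).Nonempty) ∧
          (((s : Set α) ∩ T₁).Nonempty ∨ ((s : Set α) ∩ T₃).Nonempty) ∧
          (((s : Set α) ∩ T₂).Nonempty ∨ ((s : Set α) ∩ T₃).Nonempty)) =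
        (E'.powersetCard (m + 2)).filter
        (fun s : Finset α => ((s ∩ hT1f.toFinset).Nonempty ∨ (s ∩ hT2f.toFinset).Nonempty) ∧
          ((s ∩ hT1f.toFinset).Nonempty ∨ (s ∩ hT3f.toFinset).Nonempty) ∧
          ((s ∩ hT2f.toFinset).Nonempty ∨ (s ∩ hT3f.toFinset).Nonempty)) := by
      apply Finset.filter_congr
      intro s _
      rw [(hcoe s).1, (hcoe s).2.1, (hcoe s).2.2]
    rw [hcongr]
    exact card_filter_meets_two_of_three_le E' _ _ _ (m + 2)
  have h₃ : Y₃.ncard + (E' \ hT1f.toFinset).card.choose (m + 3) + (E' \ hT2f.toFinset).card.choose (m + 3)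
      + (E' \ hT3f.toFinset).card.choose (m + 3)
      + (E' \ (hT1f.toFinset ∪ hT2f.toFinset ∪ hT3f.toFinset)).card.choose (m + 3)
      = n.choose (m + 3) + (E' \ (hT1f.toFinset ∪ hT2f.toFinset)).card.choose (m + 3)
        + (E' \ (hT1f.toFinset ∪ hT3f.toFinset)).card.choose (m + 3)
        + (E' \ (hT2f.toFinset ∪ hT3f.toFinset)).card.choose (m + 3) := by
    rw [hY₃, ncard_subsets_ncard_eq_filter E' (m + 3)
      (fun Y : Set α => (Y ∩ T₁).Nonempty ∧ (Y ∩ T₂).Nonempty ∧ (Y ∩ T₃).Nonempty)]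
    have hcongr : (E'.powersetCard (m + 3)).filter
        (fun s : Finset α => ((s : Set α) ∩ T₁).Nonempty ∧ ((s : Set α) ∩ T₂).Nonempty ∧
          ((s : Set α) ∩ T₃).Nonempty) =
        (E'.powersetCard (m + 3)).filter
        (fun s : Finset α => (s ∩ hT1f.toFinset).Nonempty ∧ (s ∩ hT2f.toFinset).Nonempty ∧
          (s ∩ hT3f.toFinset).Nonempty) := by
      apply Finset.filter_congr
      intro s _
      rw [(hcoe s).1, (hcoe s).2.1, (hcoe s).2.2]
    rw [hcongr]
    exact card_filter_meets_three E' _ _ _ (m + 3)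
  -- the cardinalities of the differences
  have hd1 : (E' \ hT1f.toFinset).card = n - 3 := by rw [Finset.card_sdiff_of_subset hS1E, hc1']
  have hd2 : (E' \ hT2f.toFinset).card = n - 3 := by rw [Finset.card_sdiff_of_subset hS2E, hc2']
  have hd3 : (E' \ hT3f.toFinset).card = n - 3 := by rw [Finset.card_sdiff_of_subset hS3E, hc3']
  have hd12 : (E' \ (hT1f.toFinset ∪ hT2f.toFinset)).card = n - (hT1f.toFinset ∪ hT2f.toFinset).card :=
    Finset.card_sdiff_of_subset hSU12
  have hd13 : (E' \ (hT1f.toFinset ∪ hT3f.toFinset)).card = n - (hT1f.toFinset ∪ hT3f.toFinset).card :=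
    Finset.card_sdiff_of_subset hSU13
  have hd23 : (E' \ (hT2f.toFinset ∪ hT3f.toFinset)).card = n - (hT2f.toFinset ∪ hT3f.toFinset).card :=
    Finset.card_sdiff_of_subset hSU23
  have hd123 : (E' \ (hT1f.toFinset ∪ hT2f.toFinset ∪ hT3f.toFinset)).card =
      n - (hT1f.toFinset ∪ hT2f.toFinset ∪ hT3f.toFinset).card := Finset.card_sdiff_of_subset hSU
  rw [hd1, hd2, hd3, hd12, hd13, hd23, hd123] at h₃
  rw [hd12] at h₂
  rw [hd123] at h₁
  have hu12' : (hT1f.toFinset ∪ hT2f.toFinset).card ≤ 6 := by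
    have := Finset.card_union_le hT1f.toFinset hT2f.toFinset; omega
  have hm9a : (n - 9).choose (m + 1) ≤ (n - (hT1f.toFinset ∪ hT2f.toFinset ∪ hT3f.toFinset).card).choose (m + 1) :=
    Nat.choose_le_choose _ (by omega)
  have hm6 : (n - 6).choose (m + 2) ≤ (n - (hT1f.toFinset ∪ hT2f.toFinset).card).choose (m + 2) :=
    Nat.choose_le_choose _ (by omega)
  have hm9b : (n - 9).choose (m + 3) ≤ (n - (hT1f.toFinset ∪ hT2f.toFinset ∪ hT3f.toFinset).card).choose (m + 3) :=
    Nat.choose_le_choose _ (by omega)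
  have hm5a : (n - (hT1f.toFinset ∪ hT2f.toFinset).card).choose (m + 3) ≤ (n - 5).choose (m + 3) :=
    Nat.choose_le_choose _ (by omega)
  have hm5b : (n - (hT1f.toFinset ∪ hT3f.toFinset).card).choose (m + 3) ≤ (n - 5).choose (m + 3) :=
    Nat.choose_le_choose _ (by omega)
  have hm5c : (n - (hT2f.toFinset ∪ hT3f.toFinset).card).choose (m + 3) ≤ (n - 5).choose (m + 3) :=
    Nat.choose_le_choose _ (by omega)
  have hsum : ∑ j ∈ Finset.range (m + 3 + 1), n.choose j =
      (∑ j ∈ Finset.range (m + 1), n.choose j) + n.choose (m + 1) + n.choose (m + 2) + n.choose (m + 3) := by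
    rw [show m + 3 + 1 = m + 1 + 1 + 1 + 1 by ring, Finset.sum_range_succ, Finset.sum_range_succ,
      Finset.sum_range_succ]
  rw [show m + 3 - 2 = m + 1 by omega, show m + 3 - 1 = m + 2 by omega, hsum]
  omega


end Matroid

end PercRepro
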